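import Mathlib
import Literature.Computability.AlgebraicComplexity.PermanentIrreducible
import Literature.Computability.AlgebraicComplexity.VonZurGathenSingPermHeight
import Summits.ValiantsHypothesis.ValiantsHypothesis.Theorems.PolyaContinuedLaplaceRigiditySingMultigrading
import Summits.ValiantsHypothesis.ValiantsHypothesis.Theorems.PolyaContinuedLaplaceRigiditySingKCoreStubs
import Summits.ValiantsHypothesis.ValiantsHypothesis.Theorems.PolyaContinuedLaplaceRigiditySingTopLines
import Summits.ValiantsHypothesis.ValiantsHypothesis.Theorems.PolyaContinuedLaplaceRigiditySingTopZeroLine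
import Summits.ValiantsHypothesis.ValiantsHypothesis.Theorems.PolyaContinuedLaplaceRigidityTwoLineCase
import HarnessLib

/-!
# TOP-PRIME RIGIDITY of `Sing(per₄)` — the line's stub B assembled Theorems-side: every prime `P ⊇ singPermIdeal ℂ 4`
# of height `≤ 8` has all its quadrics in the variable ideal of some row `i ∪` column `c`, or is the ideal of two
# rows / two columns

Helper file for the CLOSER of the support item `StrengthTwoPerFourGeFive` (stmt-ValiantsHypothesis-27571, tenure g12
2026-08-28 11:21Z per director-valiant g13 R226; «Theorems port by port-2 g1»): the def-free Theorems-side assembly of stub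
B of val-idea-10 g3's line `Cruxes/CoverDecancellation/Lines/component_rigidity.lean` v8.1 (sorry-free end to end in the
workfile; crit-3 g3 kernel probe), over the LANDED producers' theorems BY NAME:

* the K-core T7/T8 — 17819-w1 g2's `SingCodim.kcore_noVar` / `SingCodim.kcore_noBinomial` (p627865 `…SingKCoreStubs`,
  over p625549 LemmaA / p625969 Kernel / p626296 Line / p626822 Octic / p627111 Binomial);
* types (L)/(X) — 17819-w1 g2's `SingCodim.eq_span_X_twoRows` / `eq_span_X_twoCols` / `quadric_mem_span_rowCol` (p624852);
* the zero line — 17819-w1 g2's `SingCodim.row_or_col_subset_of_singPermIdeal_four_le` (p623618);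
* torus stability — val-port-4 g1's `SingGrading.weightedHomogeneousComponent_mem_of_singPermIdeal_four_le_complex` (p625923),
  instantiated with Kirkup's weight `w(x_{ρc}) = 2^ρ + 16·2^c` (the workfile's `wK`, here written inline).

Ported here (verbatim workfile bodies modulo unfolding `cellIdeal`/`rowCol`/`twoRows`/`twoCols`/`rowCells`/`R44`/`wK`/`tr`;
NO definitions): the LEMMA B weight machinery, ★ `kcore_grading` (LEMMA B, grading half), ★ `rowPrimeRigidity`,
`colPrimeRigidity` (transpose), ★★ `topPrimeRigidity` = the line's `TopPrimeRigidity` UNFOLDED, a THEOREM.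
HONEST FRAMING: this is the hypothesis of the rung `str₂(per₄) ≥ 5` (support item 27571, strictly below the GATED 25160 and
not bearing on the HELD crux 17819 `CoverDecancellation`); nothing here bears on `VP ≠ VNP`, which is NOT proved.
[Kirkup2008, Thm 14 / Prop 11; AlperBogartVelasco2017, §1]
-/

set_option autoImplicit false

-- the mandated summit-side namespace repeats a component by design (single-problem summit)
set_option linter.dupNamespace false

noncomputable section

open MvPolynomial Finsupp

namespace Summit.ValiantsHypothesis.ValiantsHypothesis.Theorems.PolyaContinuedLaplaceRigidity

namespace TopPrime

open Literature.Computability.AlgebraicComplexity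

/-! ## The LEMMA B weight `w(x_{ρc}) = 2^ρ + 16·2^c` and its decoding -/

/-- degree-two exponent vectors are pairs -/
theorem exists_pair_of_weight_one_eq_two {σ : Type*} (d : σ →₀ ℕ)
    (h : weight (1 : σ → ℕ) d = 2) : ∃ a b : σ, d = single a 1 + single b 1 := by
  classical
  have hcard : Multiset.card (toMultiset d) = 2 := by
    rw [card_toMultiset]
    simpa [weight_apply, Finsupp.sum] using h
  obtain ⟨x, y, hxy⟩ := Multiset.card_eq_two.1 hcard
  refine ⟨x, y, ?_⟩
  have := congrArg Multiset.toFinsupp hxy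
  rw [Finsupp.toMultiset_toFinsupp] at this
  rw [this, Multiset.insert_eq_cons, ← Multiset.singleton_add, Multiset.toFinsupp_add,
    Multiset.toFinsupp_singleton, Multiset.toFinsupp_singleton]

/-- `2^x + 2^y` determines `{x, y}` on `Fin 4` -/
theorem pow_pair_decode : ∀ x y x' y' : Fin 4,
    2 ^ (x' : ℕ) + 2 ^ (y' : ℕ) = 2 ^ (x : ℕ) + 2 ^ (y : ℕ) →
      (x' = x ∧ y' = y) ∨ (x' = y ∧ y' = x) := by
  decide

/-- `2 ≤ 2^x + 2^y ≤ 16` on `Fin 4` -/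
theorem pow_pair_bounds : ∀ x y : Fin 4,
    2 ≤ 2 ^ (x : ℕ) + 2 ^ (y : ℕ) ∧ 2 ^ (x : ℕ) + 2 ^ (y : ℕ) ≤ 16 := by
  decide

/-- the weight of a degree-two monomial determines its row pair and its column pair -/
theorem wK_decode (a b a' b' : Fin 4 × Fin 4)
    (h : (2 ^ (a'.1 : ℕ) + 16 * 2 ^ (a'.2 : ℕ)) + (2 ^ (b'.1 : ℕ) + 16 * 2 ^ (b'.2 : ℕ)) =
      (2 ^ (a.1 : ℕ) + 16 * 2 ^ (a.2 : ℕ)) + (2 ^ (b.1 : ℕ) + 16 * 2 ^ (b.2 : ℕ))) :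
    ((a'.1 = a.1 ∧ b'.1 = b.1) ∨ (a'.1 = b.1 ∧ b'.1 = a.1)) ∧
    ((a'.2 = a.2 ∧ b'.2 = b.2) ∨ (a'.2 = b.2 ∧ b'.2 = a.2)) := by
  have hb1 := pow_pair_bounds a.1 b.1
  have hb2 := pow_pair_bounds a'.1 b'.1
  have hb3 := pow_pair_bounds a.2 b.2
  have hb4 := pow_pair_bounds a'.2 b'.2
  have hrows : 2 ^ (a'.1 : ℕ) + 2 ^ (b'.1 : ℕ) = 2 ^ (a.1 : ℕ) + 2 ^ (b.1 : ℕ) := by omega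
  have hcols : 2 ^ (a'.2 : ℕ) + 2 ^ (b'.2 : ℕ) = 2 ^ (a.2 : ℕ) + 2 ^ (b.2 : ℕ) := by omega
  exact ⟨pow_pair_decode _ _ _ _ hrows, pow_pair_decode _ _ _ _ hcols⟩

/-- the weight of `x_a x_b` -/
theorem weight_wK_pair (a b : Fin 4 × Fin 4) :
    weight (fun e : Fin 4 × Fin 4 => 2 ^ (e.1 : ℕ) + 16 * 2 ^ (e.2 : ℕ)) (single a 1 + single b 1) =
      (2 ^ (a.1 : ℕ) + 16 * 2 ^ (a.2 : ℕ)) + (2 ^ (b.1 : ℕ) + 16 * 2 ^ (b.2 : ℕ)) := by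
  simp [weight_single]

/-- `c · x_u x_v` as a monomial -/
theorem monomial_pair_eq (u v : Fin 4 × Fin 4) (c : ℂ) :
    (monomial (single u 1 + single v 1) c : MvPolynomial (Fin 4 × Fin 4) ℂ) = C c * (X u * X v) := by
  rw [monomial_single_add, pow_one, ← C_mul_X_eq_monomial]; ring

/-! ## LEMMA B, grading half -/

/-- ★ **LEMMA B, grading half.**  If `P` (prime, height `≤ 8`, over `singPermIdeal ℂ 4`) contains no variable outside row
`i` and no K8-binomial `x_{ρc}x_{ρ'c'} − γ·x_{ρc'}x_{ρ'c}` (`ρ, ρ' ≠ i` distinct, `c ≠ c'`, `γ ≠ 0`), then every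
homogeneous quadric of `P` lies in `(x_e : e ∈ row i)`.  Proof: `P` is closed under the components of Kirkup's weight
`w(x_{ρc}) = 2^ρ + 16·2^c` (`SingGrading.weightedHomogeneousComponent_mem_of_singPermIdeal_four_le_complex`); the
`w`-component of a quadric `f ∈ P` through a monomial `x_a x_b` avoiding row `i` is supported on the (row-pair, column-pair)
class of `x_a x_b` (`wK_decode`), i.e. it is `α·x_a x_b + β·x_{(a₁,b₂)} x_{(b₁,a₂)}`; primality + no-variable + no-binomial
kill it, so no such monomial occurs (`mem_ideal_span_X_image`).  (Port of the workfile's `kcore_grading`, v6.)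
[cite: Kirkup2008, Prop 11] -/
theorem kcore_grading (P : Ideal (MvPolynomial (Fin 4 × Fin 4) ℂ)) [hP : P.IsPrime]
    (hle : VonZurGathen.singPermIdeal ℂ 4 ≤ P) (h8 : P.height ≤ 8) (i : Fin 4)
    (hnoVar : ∀ e : Fin 4 × Fin 4, e.1 ≠ i → (X e : MvPolynomial (Fin 4 × Fin 4) ℂ) ∉ P)
    (hnoBin : ∀ ρ ρ' c c' : Fin 4, ρ ≠ i → ρ' ≠ i → ρ ≠ ρ' → c ≠ c' → ∀ γ : ℂ, γ ≠ 0 →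
      (X (ρ, c) * X (ρ', c') - C γ * (X (ρ, c') * X (ρ', c)) : MvPolynomial (Fin 4 × Fin 4) ℂ) ∉ P) :
    ∀ f ∈ P, f.IsHomogeneous 2 →
      f ∈ Ideal.span ((fun e => (X e : MvPolynomial (Fin 4 × Fin 4) ℂ)) ''
        ((Finset.univ.filter fun e : Fin 4 × Fin 4 => e.1 = i) : Set (Fin 4 × Fin 4))) := by
  classical
  intro f hf hhom
  rw [mem_ideal_span_X_image]
  intro d hd
  by_contra hcon
  push Not at hcon
  have hcompP : ∀ m : ℕ,
      weightedHomogeneousComponent (fun e : Fin 4 × Fin 4 => 2 ^ (e.1 : ℕ) + 16 * 2 ^ (e.2 : ℕ)) m f ∈ P :=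
    fun m => SingGrading.weightedHomogeneousComponent_mem_of_singPermIdeal_four_le_complex
      (fun r : Fin 4 => 2 ^ (r : ℕ)) (fun c : Fin 4 => 16 * 2 ^ (c : ℕ)) P hle h8 hf m
  have hd2 : weight (1 : Fin 4 × Fin 4 → ℕ) d = 2 := hhom (MvPolynomial.mem_support_iff.1 hd)
  obtain ⟨a, b, rfl⟩ := exists_pair_of_weight_one_eq_two d hd2
  have hrow_of : ∀ e : Fin 4 × Fin 4,
      (single a 1 + single b 1 : (Fin 4 × Fin 4) →₀ ℕ) e ≠ 0 → e.1 ≠ i := by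
    intro e he hei
    exact he (hcon e (by simp [hei]))
  have ha : a.1 ≠ i := hrow_of a (by rw [Finsupp.add_apply, single_eq_same]; omega)
  have hb : b.1 ≠ i := hrow_of b (by rw [Finsupp.add_apply, single_eq_same]; omega)
  -- the `w`-component of `f` through the monomial `x_a x_b`
  set m := (2 ^ (a.1 : ℕ) + 16 * 2 ^ (a.2 : ℕ)) + (2 ^ (b.1 : ℕ) + 16 * 2 ^ (b.2 : ℕ)) with hm
  set g := weightedHomogeneousComponent (fun e : Fin 4 × Fin 4 => 2 ^ (e.1 : ℕ) + 16 * 2 ^ (e.2 : ℕ)) m f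
    with hg
  have hgP : g ∈ P := hcompP m
  have hcg : ∀ d', coeff d' g =
      if weight (fun e : Fin 4 × Fin 4 => 2 ^ (e.1 : ℕ) + 16 * 2 ^ (e.2 : ℕ)) d' = m then coeff d' f else 0 :=
    fun d' => by rw [hg, coeff_weightedHomogeneousComponent]
  -- its support: the (row-pair, column-pair) class of `x_a x_b`
  set dt : (Fin 4 × Fin 4) →₀ ℕ := single (a.1, b.2) 1 + single (b.1, a.2) 1 with hdt
  have hsupp : ∀ d' : (Fin 4 × Fin 4) →₀ ℕ, coeff d' g ≠ 0 →
      d' = single a 1 + single b 1 ∨ d' = dt := by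
    intro d' hd'
    rw [hcg] at hd'
    split_ifs at hd' with hw
    · obtain ⟨a', b', rfl⟩ := exists_pair_of_weight_one_eq_two d' (hhom hd')
      rw [weight_wK_pair] at hw
      obtain ⟨hr, hc⟩ := wK_decode a b a' b' hw
      rcases hr with ⟨h1, h2⟩ | ⟨h1, h2⟩ <;> rcases hc with ⟨h3, h4⟩ | ⟨h3, h4⟩
      · left
        rw [show a' = a from Prod.ext h1 h3, show b' = b from Prod.ext h2 h4]
      · right
        rw [show a' = (a.1, b.2) from Prod.ext h1 h3, show b' = (b.1, a.2) from Prod.ext h2 h4]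
      · right
        rw [show a' = (b.1, a.2) from Prod.ext h1 h3, show b' = (a.1, b.2) from Prod.ext h2 h4,
          add_comm]
      · left
        rw [show a' = b from Prod.ext h1 h3, show b' = a from Prod.ext h2 h4, add_comm]
    · exact absurd rfl hd'
  -- a nonzero scalar multiple of `x_a x_b` in `P` is impossible
  have hmono : ∀ c : ℂ, c ≠ 0 →
      (monomial (single a 1 + single b 1) c : MvPolynomial (Fin 4 × Fin 4) ℂ) ∈ P → False := by
    intro c hc hmem
    rw [monomial_pair_eq] at hmem
    have h1 : (X a * X b : MvPolynomial (Fin 4 × Fin 4) ℂ) ∈ P := by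
      rcases hP.mem_or_mem hmem with h | h
      · exact absurd (P.eq_top_of_isUnit_mem h ((IsUnit.mk0 c hc).map C)) hP.ne_top
      · exact h
    rcases hP.mem_or_mem h1 with h | h
    · exact hnoVar a ha h
    · exact hnoVar b hb h
  have hα : coeff (single a 1 + single b 1) f ≠ 0 := MvPolynomial.mem_support_iff.1 hd
  have hcd : coeff (single a 1 + single b 1) g = coeff (single a 1 + single b 1) f := by
    rw [hcg, if_pos (by rw [weight_wK_pair])]
  by_cases hdeg : a.1 = b.1 ∨ a.2 = b.2
  · -- one monomial in the class
    have hdt_eq : dt = single a 1 + single b 1 := by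
      rcases hdeg with h | h
      · have e1 : ((a.1, b.2) : Fin 4 × Fin 4) = b := Prod.ext h rfl
        have e2 : ((b.1, a.2) : Fin 4 × Fin 4) = a := Prod.ext h.symm rfl
        rw [hdt, e1, e2, add_comm]
      · have e1 : ((a.1, b.2) : Fin 4 × Fin 4) = a := Prod.ext rfl h.symm
        have e2 : ((b.1, a.2) : Fin 4 × Fin 4) = b := Prod.ext rfl h
        rw [hdt, e1, e2]
    have hs : g.support ⊆ {single a 1 + single b 1} := by
      intro v hv
      rcases hsupp v (MvPolynomial.mem_support_iff.1 hv) with h | h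
      · simp [h]
      · simp [h, hdt_eq]
    have hg_eq : g = monomial (single a 1 + single b 1) (coeff (single a 1 + single b 1) f) := by
      conv_lhs => rw [g.as_sum, Finset.sum_subset hs (fun v _ hv => by
        rw [MvPolynomial.notMem_support_iff.1 hv, map_zero]), Finset.sum_singleton]
      rw [hcd]
    exact hmono _ hα (hg_eq ▸ hgP)
  · -- a genuine binomial class
    push Not at hdeg
    obtain ⟨h1, h2⟩ := hdeg
    have hne : single a 1 + single b 1 ≠ dt := by
      intro h
      have := Finsupp.ext_iff.1 h a
      have e1 : a ≠ ((a.1, b.2) : Fin 4 × Fin 4) := fun e => h2 (by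
        have := congrArg Prod.snd e; simpa using this)
      have e2 : a ≠ ((b.1, a.2) : Fin 4 × Fin 4) := fun e => h1 (by
        have := congrArg Prod.fst e; simpa using this)
      simp only [hdt, Finsupp.add_apply, single_eq_same, single_eq_of_ne e1, single_eq_of_ne e2]
        at this
      omega
    have hwdt : weight (fun e : Fin 4 × Fin 4 => 2 ^ (e.1 : ℕ) + 16 * 2 ^ (e.2 : ℕ)) dt = m := by
      rw [hdt, weight_wK_pair, hm]
      ring
    set α := coeff (single a 1 + single b 1) f with hαd
    set β := coeff dt f with hβd
    have hcdt : coeff dt g = β := by rw [hcg, if_pos hwdt]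
    have hs : g.support ⊆ {single a 1 + single b 1, dt} := by
      intro v hv
      rcases hsupp v (MvPolynomial.mem_support_iff.1 hv) with h | h <;> simp [h]
    have hg_eq : g = monomial (single a 1 + single b 1) α + monomial dt β := by
      conv_lhs => rw [g.as_sum, Finset.sum_subset hs (fun v _ hv => by
        rw [MvPolynomial.notMem_support_iff.1 hv, map_zero]), Finset.sum_pair hne]
      rw [hcd, hcdt]
    by_cases hβ : β = 0
    · refine hmono α hα ?_
      have : g = monomial (single a 1 + single b 1) α := by rw [hg_eq, hβ, map_zero, add_zero]
      exact this ▸ hgP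
    · have key : C α⁻¹ * g =
          X a * X b + C (β / α) * (X (a.1, b.2) * X (b.1, a.2)) := by
        rw [hg_eq, hdt, monomial_pair_eq, monomial_pair_eq, mul_add, div_eq_mul_inv, mul_comm β]
        simp only [← mul_assoc, ← C_mul, inv_mul_cancel₀ hα, C_1, one_mul]
      have hmem : (C α⁻¹ * g : MvPolynomial (Fin 4 × Fin 4) ℂ) ∈ P := P.mul_mem_left _ hgP
      rw [key] at hmem
      have hmem' : (X (a.1, a.2) * X (b.1, b.2) - C (-(β / α)) * (X (a.1, b.2) * X (b.1, a.2)) :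
          MvPolynomial (Fin 4 × Fin 4) ℂ) ∈ P := by
        rw [map_neg, neg_mul, sub_neg_eq_add]
        exact hmem
      exact hnoBin a.1 b.1 a.2 b.2 ha hb h1 h2 (-(β / α)) (by simp [hα, hβ]) hmem'

/-! ## B-row, B-col, and TOP-PRIME RIGIDITY -/

/-- ★ **B-row.**  A prime of height `≤ 8` over `singPermIdeal ℂ 4` containing the variables of row `i` either has all its
homogeneous quadrics in `(x_e : e ∈ row i ∪ col c)` for some column `c` (types (X), (K)), or is the ideal of two rows
(type (L)).  (Port of the workfile's `rowPrimeRigidity_of_kcore`; T7/T8 = `SingCodim.kcore_noVar` / `kcore_noBinomial`.)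
[cite: Kirkup2008, Thm 14] -/
theorem rowPrimeRigidity (P : Ideal (MvPolynomial (Fin 4 × Fin 4) ℂ)) [hP : P.IsPrime]
    (hle : VonZurGathen.singPermIdeal ℂ 4 ≤ P) (h8 : P.height ≤ 8) (i : Fin 4)
    (hrow : ∀ j : Fin 4, (X (i, j) : MvPolynomial (Fin 4 × Fin 4) ℂ) ∈ P) :
    (∃ c : Fin 4, ∀ f ∈ P, f.IsHomogeneous 2 →
        f ∈ Ideal.span ((fun e => (X e : MvPolynomial (Fin 4 × Fin 4) ℂ)) ''
          ((Finset.univ.filter fun e : Fin 4 × Fin 4 => e.1 = i ∨ e.2 = c) : Set (Fin 4 × Fin 4)))) ∨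
    (∃ i' : Fin 4, i ≠ i' ∧ P = Ideal.span ((fun e => (X e : MvPolynomial (Fin 4 × Fin 4) ℂ)) ''
          ((Finset.univ.filter fun e : Fin 4 × Fin 4 => e.1 = i ∨ e.1 = i') : Set (Fin 4 × Fin 4)))) := by
  classical
  by_cases hrow' : ∃ i' : Fin 4, i' ≠ i ∧ ∀ j : Fin 4, (X (i', j) : MvPolynomial (Fin 4 × Fin 4) ℂ) ∈ P
  · obtain ⟨i', hne, hi'⟩ := hrow'
    refine Or.inr ⟨i', fun h => hne h.symm, ?_⟩
    exact SingCodim.eq_span_X_twoRows ℂ (fun h => hne h.symm) P h8 hrow hi'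
  by_cases hcol : ∃ c : Fin 4, ∀ r : Fin 4, (X (r, c) : MvPolynomial (Fin 4 × Fin 4) ℂ) ∈ P
  · obtain ⟨c, hc⟩ := hcol
    refine Or.inl ⟨c, fun f hf hhom => ?_⟩
    have hle' : BoraleviCarliniMichalekVentura2025.subpermIdeal ℂ 4 4 3 ≤ P := by
      have h := BoraleviCarliniMichalekVentura2025.singPermIdeal_eq_subpermIdeal ℂ (m := 4) (by norm_num)
      rw [h] at hle
      exact hle
    exact SingCodim.quadric_mem_span_rowCol ℂ i c P hle' h8 hrow hc f hf hhom
  · push Not at hrow' hcol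
    have hnv := SingCodim.kcore_noVar P hle h8 i hrow hrow' hcol
    have hnb := SingCodim.kcore_noBinomial P hle h8 i hrow hrow' hcol
    refine Or.inl ⟨0, fun f hf hhom => ?_⟩
    have hf' := kcore_grading P hle h8 i hnv hnb f hf hhom
    refine Ideal.span_mono (Set.image_mono fun e he => ?_) hf'
    rw [Finset.mem_coe, Finset.mem_filter] at he ⊢
    exact ⟨he.1, Or.inl he.2⟩

/-- `singPermIdeal ℂ 4` is carried into any ideal containing it by the transpose automorphism. -/
theorem singPermIdeal_le_comap_swap {P : Ideal (MvPolynomial (Fin 4 × Fin 4) ℂ)}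
    (h : VonZurGathen.singPermIdeal ℂ 4 ≤ P) :
    VonZurGathen.singPermIdeal ℂ 4 ≤
      P.comap (MvPolynomial.renameEquiv ℂ (Equiv.prodComm (Fin 4) (Fin 4))).toRingEquiv := by
  have happ : ∀ f : MvPolynomial (Fin 4 × Fin 4) ℂ,
      (MvPolynomial.renameEquiv ℂ (Equiv.prodComm (Fin 4) (Fin 4))).toRingEquiv f = rename Prod.swap f :=
    fun _ => rfl
  unfold VonZurGathen.singPermIdeal
  rw [Ideal.span_le]
  rintro g hg
  rw [SetLike.mem_coe, Ideal.mem_comap, happ]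
  rcases hg with rfl | ⟨e, rfl⟩
  · rw [TwoLine.rename_swap_perPoly]; exact h (VonZurGathen.perPoly_mem_singPermIdeal ℂ 4)
  · show rename Prod.swap (pderiv e (perPoly (Fin 4) ℂ)) ∈ P
    rw [← pderiv_rename Prod.swap_injective, TwoLine.rename_swap_perPoly]
    exact h (Ideal.subset_span (Set.mem_insert_of_mem _ ⟨e.swap, rfl⟩))

/-- the transpose maps the variable ideal of a cell set to that of the transposed cell set -/
theorem map_swap_span_X (S : Finset (Fin 4 × Fin 4)) :
    (Ideal.span ((fun e => (X e : MvPolynomial (Fin 4 × Fin 4) ℂ)) '' (S : Set (Fin 4 × Fin 4)))).map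
        (MvPolynomial.renameEquiv ℂ (Equiv.prodComm (Fin 4) (Fin 4))).toRingEquiv =
      Ideal.span ((fun e => (X e : MvPolynomial (Fin 4 × Fin 4) ℂ)) ''
        ((S.image Prod.swap : Finset (Fin 4 × Fin 4)) : Set (Fin 4 × Fin 4))) := by
  have hX : ∀ e : Fin 4 × Fin 4,
      (MvPolynomial.renameEquiv ℂ (Equiv.prodComm (Fin 4) (Fin 4))).toRingEquiv
        (X e : MvPolynomial (Fin 4 × Fin 4) ℂ) = X e.swap := fun e => by
    show rename Prod.swap (X e) = X e.swap
    rw [rename_X]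
  rw [Ideal.map_span, ← Set.image_comp, Finset.coe_image, ← Set.image_comp]
  congr 1
  ext f
  simp only [Set.mem_image, Function.comp_apply]
  constructor
  · rintro ⟨e, he, rfl⟩; exact ⟨e, he, (hX e).symm⟩
  · rintro ⟨e, he, rfl⟩; exact ⟨e, he, hX e⟩

/-- the transpose of row `i ∪` column `c` is row `c ∪` column `i` -/
theorem image_swap_rowCol (i c : Fin 4) :
    (Finset.univ.filter fun e : Fin 4 × Fin 4 => e.1 = i ∨ e.2 = c).image Prod.swap =
      Finset.univ.filter fun e : Fin 4 × Fin 4 => e.1 = c ∨ e.2 = i := by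
  ext e
  simp only [Finset.mem_image, Finset.mem_filter, Finset.mem_univ, true_and]
  constructor
  · rintro ⟨e', h, rfl⟩; simpa [or_comm] using h
  · intro h; exact ⟨e.swap, by simpa [or_comm] using h, Prod.swap_swap e⟩

/-- the transpose of two rows is two columns -/
theorem image_swap_twoRows (i i' : Fin 4) :
    (Finset.univ.filter fun e : Fin 4 × Fin 4 => e.1 = i ∨ e.1 = i').image Prod.swap =
      Finset.univ.filter fun e : Fin 4 × Fin 4 => e.2 = i ∨ e.2 = i' := by
  ext e
  simp only [Finset.mem_image, Finset.mem_filter, Finset.mem_univ, true_and]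
  constructor
  · rintro ⟨e', h, rfl⟩; simpa using h
  · intro h; exact ⟨e.swap, by simpa using h, Prod.swap_swap e⟩

/-- ★ **B-col** (from B-row by the transpose automorphism `x_{ij} ↦ x_{ji}`). [cite: Kirkup2008, Thm 14] -/
theorem colPrimeRigidity (P : Ideal (MvPolynomial (Fin 4 × Fin 4) ℂ)) [hP : P.IsPrime]
    (hle : VonZurGathen.singPermIdeal ℂ 4 ≤ P) (h8 : P.height ≤ 8) (c : Fin 4)
    (hcol : ∀ r : Fin 4, (X (r, c) : MvPolynomial (Fin 4 × Fin 4) ℂ) ∈ P) :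
    (∃ i : Fin 4, ∀ f ∈ P, f.IsHomogeneous 2 →
        f ∈ Ideal.span ((fun e => (X e : MvPolynomial (Fin 4 × Fin 4) ℂ)) ''
          ((Finset.univ.filter fun e : Fin 4 × Fin 4 => e.1 = i ∨ e.2 = c) : Set (Fin 4 × Fin 4)))) ∨
    (∃ c' : Fin 4, c ≠ c' ∧ P = Ideal.span ((fun e => (X e : MvPolynomial (Fin 4 × Fin 4) ℂ)) ''
          ((Finset.univ.filter fun e : Fin 4 × Fin 4 => e.2 = c ∨ e.2 = c') : Set (Fin 4 × Fin 4)))) := by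
  set tr := (MvPolynomial.renameEquiv ℂ (Equiv.prodComm (Fin 4) (Fin 4))).toRingEquiv with htr
  have tr_apply : ∀ f : MvPolynomial (Fin 4 × Fin 4) ℂ, tr f = rename Prod.swap f := fun _ => rfl
  have tr_X : ∀ e : Fin 4 × Fin 4, tr (X e) = X e.swap := fun e => by rw [tr_apply, rename_X]
  have tr_tr : ∀ f : MvPolynomial (Fin 4 × Fin 4) ℂ, tr (tr f) = f := fun f => by
    rw [tr_apply, tr_apply, rename_rename, Prod.swap_swap_eq, rename_id]
    rfl
  -- the transposed prime
  haveI hQP : (P.comap tr).IsPrime := Ideal.comap_isPrime tr P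
  have hQle : VonZurGathen.singPermIdeal ℂ 4 ≤ P.comap tr := singPermIdeal_le_comap_swap hle
  have hQ8 : (P.comap tr).height ≤ 8 := by rw [RingEquiv.height_comap]; exact h8
  have hrow : ∀ j : Fin 4, (X (c, j) : MvPolynomial (Fin 4 × Fin 4) ℂ) ∈ P.comap tr := by
    intro j; rw [Ideal.mem_comap, tr_X]; exact hcol j
  rcases rowPrimeRigidity (P.comap tr) hQle hQ8 c hrow with ⟨c', h⟩ | ⟨i', hci', h⟩
  · refine Or.inl ⟨c', fun f hf hf2 => ?_⟩
    have htf : tr f ∈ P.comap tr := by rw [Ideal.mem_comap, tr_tr]; exact hf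
    have htf2 : (tr f).IsHomogeneous 2 := by rw [tr_apply]; exact hf2.rename_isHomogeneous
    have hmem := Ideal.mem_map_of_mem tr (h (tr f) htf htf2)
    rwa [tr_tr, htr, map_swap_span_X, image_swap_rowCol] at hmem
  · refine Or.inr ⟨i', hci', ?_⟩
    have := congrArg (Ideal.map tr) h
    rwa [Ideal.map_comap_of_surjective _ tr.surjective, htr, map_swap_span_X, image_swap_twoRows] at this

/-- ★★ **TOP-PRIME RIGIDITY of `Sing(per₄)`** (the line's stub B `TopPrimeRigidity`, unfolded, a THEOREM): every prime
`P ⊇ singPermIdeal ℂ 4` of height `≤ 8` — the ideal of a top-dimensional component of `Sing(per₄)` — EITHER has all its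
homogeneous quadrics in the variable ideal of some row `i ∪` column `c` (Kirkup's types (X) = zero row + zero column + `per₃`,
and (K) = zero line + the kernel incidence of the octic `det M(u,v)`), OR is the ideal of two rows / two columns (type (L)).
Zero line (`SingCodim.row_or_col_subset_of_singPermIdeal_four_le`) + B-row + B-col. [cite: Kirkup2008, Thm 14] -/
theorem topPrimeRigidity :
    ∀ P : Ideal (MvPolynomial (Fin 4 × Fin 4) ℂ), P.IsPrime →
      VonZurGathen.singPermIdeal ℂ 4 ≤ P → P.height ≤ 8 →
        (∃ i c : Fin 4, ∀ f ∈ P, f.IsHomogeneous 2 →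
            f ∈ Ideal.span ((fun e => (X e : MvPolynomial (Fin 4 × Fin 4) ℂ)) ''
              ((Finset.univ.filter fun e : Fin 4 × Fin 4 => e.1 = i ∨ e.2 = c) : Set (Fin 4 × Fin 4)))) ∨
        (∃ i i' : Fin 4, i ≠ i' ∧
          (P = Ideal.span ((fun e => (X e : MvPolynomial (Fin 4 × Fin 4) ℂ)) ''
              ((Finset.univ.filter fun e : Fin 4 × Fin 4 => e.1 = i ∨ e.1 = i') : Set (Fin 4 × Fin 4))) ∨
           P = Ideal.span ((fun e => (X e : MvPolynomial (Fin 4 × Fin 4) ℂ)) ''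
              ((Finset.univ.filter fun e : Fin 4 × Fin 4 => e.2 = i ∨ e.2 = i') : Set (Fin 4 × Fin 4))))) := by
  intro P hP hle h8
  rcases SingCodim.row_or_col_subset_of_singPermIdeal_four_le ℂ (by norm_num) (by norm_num) P hle h8 with
    ⟨i, hi⟩ | ⟨c, hcol⟩
  · rcases rowPrimeRigidity P hle h8 i hi with ⟨c, h⟩ | ⟨i', hii', h⟩
    · exact Or.inl ⟨i, c, h⟩
    · exact Or.inr ⟨i, i', hii', Or.inl h⟩
  · rcases colPrimeRigidity P hle h8 c hcol with ⟨i, h⟩ | ⟨c', hcc', h⟩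
    · exact Or.inl ⟨i, c, h⟩
    · exact Or.inr ⟨c, c', hcc', Or.inr h⟩

end TopPrime

end Summit.ValiantsHypothesis.ValiantsHypothesis.Theorems.PolyaContinuedLaplaceRigidity

end
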